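import Literature.NumberTheory.Rogawski1990.ArchExplicitTransferFactorCentralCurveRelabelDeriv   -- ★ G4b (F0P3a-p05 (g11)): `Δ″_ρ` flat at the centre, `∂(Δ″_ρ·F) → 0`; brings G1–G4a, ★ (V8) `ArchStableClassTorus`
import Literature.NumberTheory.Automorphic.ArchStableOrbitalSumTorusTransversal             -- ★ FILE C (F0P3a-p05 (g11)): `mk_archDiagTorus_eq_mk_iff_forall`
import Literature.NumberTheory.Automorphic.ArchLocalRegularTorusClasses                     -- ★ `mk_circleDiagonal_eq_mk_iff_image_eq_image` (regular torus classes ↔ `ρ(P)`)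
import Mathlib.MeasureTheory.Group.Integral
import HarnessLib

/-!
# Lemma 14.5.2 (c) at `∞`, the `G′`-side of (vi) along the central curve: class bookkeeping and flatness modulo the orbital-integral smoothness
# (Rogawski 1990 §14.5 Lemma 14.5.2 (c) p. 238; §4.1 (4.1.1) p. 39; §4.3 p. 43)

Topic `NumberTheory/Rogawski1990`; namespace `Literature.NumberTheory.Rogawski1990`.  THEOREMS ONLY (no definition, no named fact, no instance, no notation, no `sorry`).
Cell `pub/hodgecm-mathlib`, ENGINE T1 (crux H413 = `stmt-HodgeConjecture-24833`); floor-1½ preparation, count-neutral, under row (S-c) ∕ `stub_ScCore` of the «SdArch» pay-down line: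
brick **(3G) «G′-SIDE OF (vi) ALONG THE CENTRAL CURVE IS FLAT»** of F0P3a-p02 (g10)'s (R3-f) STEP 3 census (05:27Z), parts (3G-a) (class bookkeeping) + (3G-d) (assembly) — the orbital
smoothness (3G-b) enters as the hypothesis `hO` (discharged separately); LEAD F0P3a-plan (g9) T8-73 (A) ∕ T8-76 (C) (consumer: the `stub_ScCore` closer, pen F0P3a-p03 (g10)); author F0P3a-p05 (g11).

THE MATHEMATICS.  Fix `H′ = diag α` (anisotropic hermitian, `α_i ≠ 0` real), an archimedean transfer factor `T` on the ray of print's `Δ″` (`T.Δ = c_T · archExplicitDelta`), a right-invariant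
measure `ν′` on `G′_∞ = U(H′)(L⁺ ⊗ ℝ)` and a test function `a′`.  Along ★ B-p12's lifted curve `γ_H(ψ)` (one place `w₀` moving at speed `c_{w₀} ≠ 0`, central there, the other places
sitting at torus points with pairwise distinct coordinates) the `G′`-side of (vi), `Σᶠ_{c′} T.Δ(γ_H(ψ), out c′) · ∫ a′(g·out c′·g⁻¹) dν′`, is for small `ψ ≠ 0` a FIXED finite combination
`Σ_ρ n_ρ⁻¹ · c_T · Δ″(γ_H(ψ), γ′_ρ(ψ)) · O_ρ(ψ)` over the relabellings `ρ : W → S₃` (`γ′_ρ(ψ) = t(z(ψ)∘ρ)`, `O_ρ(ψ) = ∫ a′(g γ′_ρ(ψ) g⁻¹) dν′`): the support of `c′ ↦ T.Δ(γ_H(ψ), out c′)` lies in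
the classes matching `ι(γ_H(ψ))` (`T.eq_zero_of_not_rel`), these form the stable class of `γ′(ψ) = t(z(ψ))` (★ `Corresponds.isStablyConj_right`), which is `{⟦t(z(ψ)∘ρ)⟧}_ρ` (★ (V8)
`conjClasses_stable_archDiagTorus_eq_range_of_conj`); `T.Δ(γ_H, ·)` and `O` are class functions (`T.conj_right`, right-invariance of `ν′`); and the multiplicities `n_ρ(ψ) = #{ρ′ ∣ ⟦t(z(ψ)∘ρ′)⟧ = ⟦t(z(ψ)∘ρ)⟧}`
do NOT depend on `ψ` while every `z(ψ)_w` is injective (★ `mk_circleDiagonal_eq_mk_iff_image_eq_image`: the class remembers only `ρ_w(P_w)`).  With ★ G4 (`Δ″_ρ = O(ψ²)`, `∂(Δ″_ρ·O_ρ) → 0`) the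
combination `r(ψ) = (2 sin ψ)·Σ_ρ …` is differentiable on `𝓝[≠] 0` with `r′ → 0` — the input `heq`∕`hr` of ★ p02 `sum_integral_pi_erase_eq_zero_of_eventuallyEq` on the `G′`-side.

* §1 class functions: `transferFactor_delta_out_mk` (`T.Δ a (out ⟦x⟧) = T.Δ a x`), `integral_comp_conj_out_mk` (`∫ a′(g·out⟦x⟧·g⁻¹) dν′ = ∫ a′(g x g⁻¹) dν′`, `ν′` right-invariant).
* §2 **`finsum_delta_mul_integral_eq_sum_relabel`**: the `Σᶠ` over classes `=` `Σ_ρ n_ρ(ψ)⁻¹ · (T.Δ(γ_H(ψ), γ′_ρ(ψ)) · O_ρ(ψ))` (every `ψ`).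
* §3 **`card_filter_mk_relabel_eq_of_injective`** (the multiplicities are `ψ`-free on the regular set), **`eventually_injective_centralCurve`** (`z(ψ)_w` injective for small `ψ ≠ 0`).
* §4 the model combination (any coefficients `k`, any `O_ρ`): `hasDerivAt_gSide_model`, `eventually_differentiableAt_gSide_model`, `tendsto_deriv_gSide_model`.
* §5 `finsum_delta_mul_integral_eq_model_of_injective`, **`exists_flat_gSide_centralCurve`** — p02's head: `∃ r, (∀ᶠ ψ in 𝓝[≠] 0, DifferentiableAt ℝ r ψ) ∧ Tendsto (deriv r) (𝓝[≠] 0) (𝓝 0) ∧ ∀ᶠ ψ in 𝓝[≠] 0, (2 sin ψ) • Σᶠ_{c′} T.Δ (γH ψ) (out c′) * ∫ a′(g·out c′·g⁻¹) dν′ = r ψ`,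
  modulo `hO` (each `O_ρ` differentiable near `0` with `O_ρ, O_ρ′` bounded — (3G-b)).
HONEST LABEL: HC_CM is proved only modulo the printed citations until rung 0 closes; bookkeeping + calculus, pays nothing by itself.

## References
* [Rogawski1990] J. D. Rogawski, *Automorphic Representations of Unitary Groups in Three Variables*, Ann. of Math. Stud. 123 (1990): §14.5 Lemma 14.5.2 (c), p. 238; §4.1 (4.1.1) p. 39;
  §4.3 p. 43 (`Δ` a class function); §3.8 pp. 30–32.
-/

set_option autoImplicit false

noncomputable section

open NumberField NumberField.InfinitePlace Matrix Polynomial Filter Topology Complex Equiv MeasureTheory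
open scoped MatrixGroups Real

namespace Literature.NumberTheory.Rogawski1990

open Literature.NumberTheory.Automorphic
open Literature.NumberTheory.GaloisRepresentations

/-! ## §1 Class functions: `T.Δ(γ_H, ·)` and the Haar orbital integral at `out ⟦x⟧` -/

section ClassFunction
variable (L : Type) [Field L] [NumberField L] [IsCMField L] (H' : Matrix (Fin 3) (Fin 3) L)

/-- **`T.Δ(γ_H, out ⟦x⟧) = T.Δ(γ_H, x)`** (`T.conj_right`: `out ⟦x⟧ = y x y⁻¹`). [cite: Rogawski1990, §4.3 p. 43] -/
theorem transferFactor_delta_out_mk (T : ArchTransferFactor L H')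
    (a : ↥(UnitaryGroup.arch (↥(maximalRealSubfield L)) L (IsCMField.complexConj L) 2
            (Matrix.of fun i j : Fin 2 => if i.val + j.val + 1 = 2 then (1 : L) else 0)) ×
          ↥(UnitaryGroup.arch (↥(maximalRealSubfield L)) L (IsCMField.complexConj L) 1
            (Matrix.of fun i j : Fin 1 => if i.val + j.val + 1 = 1 then (1 : L) else 0)))
    (x : ↥(UnitaryGroup.arch (↥(maximalRealSubfield L)) L (IsCMField.complexConj L) 3 H')) :
    T.Δ a (Quotient.out (ConjClasses.mk x)) = T.Δ a x := by
  obtain ⟨y, hy⟩ := isConj_iff.mp (ConjClasses.mk_eq_mk_iff_isConj.mp (Quotient.out_eq (ConjClasses.mk x)))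
  calc T.Δ a (Quotient.out (ConjClasses.mk x)) = T.Δ a (y * Quotient.out (ConjClasses.mk x) * y⁻¹) := (T.conj_right _ _ _).symm
    _ = T.Δ a x := by rw [hy]

omit [IsCMField L] in
/-- **`∫ a′(g · out ⟦x⟧ · g⁻¹) dν′ = ∫ a′(g x g⁻¹) dν′`** for a right-invariant `ν′` (substitute `g ↦ g y`). [cite: Rogawski1990, §4.3 p. 43] -/
theorem integral_comp_conj_out_mk {G : Type*} [Group G] [MeasurableSpace G] [MeasurableMul G] (ν : Measure G) [ν.IsMulRightInvariant]
    (f : G → ℂ) (x : G) :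
    ∫ g, f (g * Quotient.out (ConjClasses.mk x) * g⁻¹) ∂ν = ∫ g, f (g * x * g⁻¹) ∂ν := by
  obtain ⟨y, hy⟩ := isConj_iff.mp (ConjClasses.mk_eq_mk_iff_isConj.mp (Quotient.out_eq (ConjClasses.mk x)))
  calc ∫ g, f (g * Quotient.out (ConjClasses.mk x) * g⁻¹) ∂ν
      = ∫ g, (fun g' : G => f (g' * Quotient.out (ConjClasses.mk x) * g'⁻¹)) (g * y) ∂ν := (integral_mul_right_eq_self _ y).symm
    _ = ∫ g, f (g * x * g⁻¹) ∂ν := by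
        conv_rhs => rw [← hy]
        congr 1
        funext g
        simp only []
        congr 1
        group

end ClassFunction

section Curve

variable (L : Type) [Field L] [NumberField L] [IsCMField L] (α : Fin 3 → L)
  (z₀ : {w : InfinitePlace L // IsComplex w} → Fin 3 → Circle) (c : {w : InfinitePlace L // IsComplex w} → ℝ)
  (γH : ℝ →
    ↥(UnitaryGroup.arch (↥(maximalRealSubfield L)) L (IsCMField.complexConj L) 2
        (Matrix.of fun i j : Fin 2 => if i.val + j.val + 1 = 2 then (1 : L) else 0)) ×
      ↥(UnitaryGroup.arch (↥(maximalRealSubfield L)) L (IsCMField.complexConj L) 1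
        (Matrix.of fun i j : Fin 1 => if i.val + j.val + 1 = 1 then (1 : L) else 0)))
  (γG : ℝ → ↥(UnitaryGroup.arch (↥(maximalRealSubfield L)) L (IsCMField.complexConj L) 3 (Matrix.diagonal α)))
  (hγH : γH = fun ψ =>
    ((UnitaryGroup.archPiEquivCM 2 L (Matrix.of fun i j : Fin 2 => if i.val + j.val + 1 = 2 then (1 : L) else 0)).symm fun w =>
        ⟨Matrix.GeneralLinearGroup.mkOfDetNeZero !![(1 : ℂ), 1; 1, -1] UnitaryGroup.det_cayleyTwo_ne_zero *
            UnitaryGroup.circleDiagonal 2 ![z₀ w 0 * Circle.exp (![(1 : ℝ), 0, -1] 0 * (c w * ψ)), z₀ w 2 * Circle.exp (![(1 : ℝ), 0, -1] 2 * (c w * ψ))] *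
          (Matrix.GeneralLinearGroup.mkOfDetNeZero !![(1 : ℂ), 1; 1, -1] UnitaryGroup.det_cayleyTwo_ne_zero)⁻¹,
          UnitaryGroup.cayley_conj_circleDiagonal_mem_archLocal L w _⟩,
      (UnitaryGroup.archPiEquivCM 1 L (Matrix.of fun i j : Fin 1 => if i.val + j.val + 1 = 1 then (1 : L) else 0)).symm fun w =>
        ⟨UnitaryGroup.circleDiagonal 1 ![z₀ w 1 * Circle.exp (![(1 : ℝ), 0, -1] 1 * (c w * ψ))],
          UnitaryGroup.circleDiagonal_mem_archLocal_antidiagOne L w _⟩))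
  (hγG : γG = fun ψ => UnitaryGroup.archDiagTorus L 3 α fun w i => z₀ w i * Circle.exp (![(1 : ℝ), 0, -1] i * (c w * ψ)))

  (w₀ : {w : InfinitePlace L // IsComplex w}) (μ : HeckeCharacter L)
  (T : ArchTransferFactor L (Matrix.diagonal α))
  [MeasurableSpace ↥(UnitaryGroup.arch (↥(maximalRealSubfield L)) L (IsCMField.complexConj L) 3 (Matrix.diagonal α))] [BorelSpace ↥(UnitaryGroup.arch (↥(maximalRealSubfield L)) L (IsCMField.complexConj L) 3 (Matrix.diagonal α))]
  (ν' : Measure ↥(UnitaryGroup.arch (↥(maximalRealSubfield L)) L (IsCMField.complexConj L) 3 (Matrix.diagonal α))) [ν'.IsMulRightInvariant]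
  (a' : ↥(UnitaryGroup.arch (↥(maximalRealSubfield L)) L (IsCMField.complexConj L) 3 (Matrix.diagonal α)) → ℂ)

/-! ## §2 The `Σᶠ` over classes as a weighted sum over relabellings -/

include hγH hγG in
omit [MeasurableSpace ↥(UnitaryGroup.arch (↥(maximalRealSubfield L)) L (IsCMField.complexConj L) 3 (Matrix.diagonal α))] [BorelSpace ↥(UnitaryGroup.arch (↥(maximalRealSubfield L)) L (IsCMField.complexConj L) 3 (Matrix.diagonal α))] in
open scoped Classical in
/-- **THE SUPPORT of `c′ ↦ T.Δ(γ_H(ψ), out c′) · (anything)` LIES IN `{⟦t(z(ψ)∘ρ)⟧}_ρ`**: `T.Δ ≠ 0` forces matching (`T.eq_zero_of_not_rel`), matching classes form the stable class of `γ′(ψ) = t(z(ψ))`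
(★ `isArchNormPair_archSingularCurve`, ★ `Corresponds.isStablyConj_right`), listed by ★ (V8) `conjClasses_stable_archDiagTorus_eq_range_of_conj`. [cite: Rogawski1990, §4.1 (4.1.1) p. 39; §4.3 p. 43] -/
theorem support_delta_mul_subset_image_relabel (hα : ∀ i, α i ≠ 0) (hherm : ∀ i, (IsCMField.complexConj L (α i) : L) = α i)
    (F : ConjClasses ↥(UnitaryGroup.arch (↥(maximalRealSubfield L)) L (IsCMField.complexConj L) 3 (Matrix.diagonal α)) → ℂ) (ψ : ℝ) :
    (Function.support fun c' : ConjClasses ↥(UnitaryGroup.arch (↥(maximalRealSubfield L)) L (IsCMField.complexConj L) 3 (Matrix.diagonal α)) => T.Δ (γH ψ) (Quotient.out c') * F c') ⊆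
      ↑(Finset.univ.image fun ρ : {w : InfinitePlace L // IsComplex w} → Perm (Fin 3) => ConjClasses.mk (UnitaryGroup.archDiagTorus L 3 α fun w => (fun i : Fin 3 => z₀ w i * Circle.exp (![(1 : ℝ), 0, -1] i * (c w * ψ))) ∘ ρ w)) := by
  intro c' hc'
  rw [Function.mem_support] at hc'
  have hΔ : T.Δ (γH ψ) (Quotient.out c') ≠ 0 := fun h => hc' (by rw [h, zero_mul])
  have hrel : IsArchNormPair L (Matrix.diagonal α) (γH ψ) (Quotient.out c') := by
    by_contra h; exact hΔ (T.eq_zero_of_not_rel _ _ h)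
  have h0 := isArchNormPair_archSingularCurve L α z₀ c γH γG hγH hγG ψ
  rw [isArchNormPair_iff] at h0 hrel
  have hst := Corresponds.isStablyConj_right h0 hrel
  rw [hγG] at hst
  have hmem : c' ∈ {q : ConjClasses ↥(UnitaryGroup.arch (↥(maximalRealSubfield L)) L (IsCMField.complexConj L) 3 (Matrix.diagonal α)) |
      IsStablyConj (UnitaryGroup.conjMixed (↥(maximalRealSubfield L)) L (IsCMField.complexConj L)) (UnitaryGroup.archFormOf L 3 (Matrix.diagonal α))
        (UnitaryGroup.archDiagTorus L 3 α (fun w : {w : InfinitePlace L // IsComplex w} => fun i : Fin 3 => z₀ w i * Circle.exp (![(1 : ℝ), 0, -1] i * (c w * ψ)))) (Quotient.out q)} := hst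
  rw [UnitaryGroup.conjClasses_stable_archDiagTorus_eq_range_of_conj L 3 α hα hherm] at hmem
  obtain ⟨ρ, hρ⟩ := hmem
  rw [Finset.coe_image, Finset.coe_univ, Set.image_univ]
  exact ⟨ρ, hρ⟩

include hγH hγG in
open scoped Classical in
/-- **THE `G′`-SIDE OF (vi) AT `γ_H(ψ)` AS A WEIGHTED SUM OVER RELABELLINGS**: with `n_ρ(ψ) = #{ρ′ ∣ ⟦t(z(ψ)∘ρ′)⟧ = ⟦t(z(ψ)∘ρ)⟧}`,
`Σᶠ_{c′} T.Δ(γ_H(ψ), out c′)·∫ a′(g·out c′·g⁻¹) dν′ = Σ_ρ n_ρ(ψ)⁻¹ · (T.Δ(γ_H(ψ), t(z(ψ)∘ρ)) · ∫ a′(g·t(z(ψ)∘ρ)·g⁻¹) dν′)` — every `ψ`. [cite: Rogawski1990, §4.1 (4.1.1) p. 39; §4.3 p. 43] -/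
theorem finsum_delta_mul_integral_eq_sum_relabel (hα : ∀ i, α i ≠ 0) (hherm : ∀ i, (IsCMField.complexConj L (α i) : L) = α i) (ψ : ℝ) :
    ∑ᶠ c' : ConjClasses ↥(UnitaryGroup.arch (↥(maximalRealSubfield L)) L (IsCMField.complexConj L) 3 (Matrix.diagonal α)), T.Δ (γH ψ) (Quotient.out c') * ∫ g, a' (g * Quotient.out c' * g⁻¹) ∂ν' =
      ∑ ρ : {w : InfinitePlace L // IsComplex w} → Perm (Fin 3),
        ((Finset.univ.filter fun ρ' : {w : InfinitePlace L // IsComplex w} → Perm (Fin 3) => ConjClasses.mk (UnitaryGroup.archDiagTorus L 3 α fun w => (fun i : Fin 3 => z₀ w i * Circle.exp (![(1 : ℝ), 0, -1] i * (c w * ψ))) ∘ ρ' w) = ConjClasses.mk (UnitaryGroup.archDiagTorus L 3 α fun w => (fun i : Fin 3 => z₀ w i * Circle.exp (![(1 : ℝ), 0, -1] i * (c w * ψ))) ∘ ρ w)).card : ℂ)⁻¹ *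
          (T.Δ (γH ψ) (UnitaryGroup.archDiagTorus L 3 α fun w => (fun i : Fin 3 => z₀ w i * Circle.exp (![(1 : ℝ), 0, -1] i * (c w * ψ))) ∘ ρ w) * ∫ g, a' (g * (UnitaryGroup.archDiagTorus L 3 α fun w => (fun i : Fin 3 => z₀ w i * Circle.exp (![(1 : ℝ), 0, -1] i * (c w * ψ))) ∘ ρ w) * g⁻¹) ∂ν') := by
  rw [finsum_eq_finsetSum_of_support_subset _ (support_delta_mul_subset_image_relabel L α z₀ c γH γG hγH hγG T hα hherm
    (fun c' => ∫ g, a' (g * Quotient.out c' * g⁻¹) ∂ν') ψ)]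
  symm
  refine (Finset.sum_image' _ fun ρ _ => ?_).symm
  -- on the fibre of `ρ` every summand equals `n_ρ⁻¹ · (value at ρ)`
  rw [transferFactor_delta_out_mk, integral_comp_conj_out_mk]
  have hconst : ∀ ρ' ∈ Finset.univ.filter (fun ρ' : {w : InfinitePlace L // IsComplex w} → Perm (Fin 3) => ConjClasses.mk (UnitaryGroup.archDiagTorus L 3 α fun w => (fun i : Fin 3 => z₀ w i * Circle.exp (![(1 : ℝ), 0, -1] i * (c w * ψ))) ∘ ρ' w) = ConjClasses.mk (UnitaryGroup.archDiagTorus L 3 α fun w => (fun i : Fin 3 => z₀ w i * Circle.exp (![(1 : ℝ), 0, -1] i * (c w * ψ))) ∘ ρ w)),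
      ((Finset.univ.filter fun ρ'' : {w : InfinitePlace L // IsComplex w} → Perm (Fin 3) => ConjClasses.mk (UnitaryGroup.archDiagTorus L 3 α fun w => (fun i : Fin 3 => z₀ w i * Circle.exp (![(1 : ℝ), 0, -1] i * (c w * ψ))) ∘ ρ'' w) = ConjClasses.mk (UnitaryGroup.archDiagTorus L 3 α fun w => (fun i : Fin 3 => z₀ w i * Circle.exp (![(1 : ℝ), 0, -1] i * (c w * ψ))) ∘ ρ' w)).card : ℂ)⁻¹ *
          (T.Δ (γH ψ) (UnitaryGroup.archDiagTorus L 3 α fun w => (fun i : Fin 3 => z₀ w i * Circle.exp (![(1 : ℝ), 0, -1] i * (c w * ψ))) ∘ ρ' w) * ∫ g, a' (g * (UnitaryGroup.archDiagTorus L 3 α fun w => (fun i : Fin 3 => z₀ w i * Circle.exp (![(1 : ℝ), 0, -1] i * (c w * ψ))) ∘ ρ' w) * g⁻¹) ∂ν') =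
        ((Finset.univ.filter fun ρ' : {w : InfinitePlace L // IsComplex w} → Perm (Fin 3) => ConjClasses.mk (UnitaryGroup.archDiagTorus L 3 α fun w => (fun i : Fin 3 => z₀ w i * Circle.exp (![(1 : ℝ), 0, -1] i * (c w * ψ))) ∘ ρ' w) = ConjClasses.mk (UnitaryGroup.archDiagTorus L 3 α fun w => (fun i : Fin 3 => z₀ w i * Circle.exp (![(1 : ℝ), 0, -1] i * (c w * ψ))) ∘ ρ w)).card : ℂ)⁻¹ *
          (T.Δ (γH ψ) (UnitaryGroup.archDiagTorus L 3 α fun w => (fun i : Fin 3 => z₀ w i * Circle.exp (![(1 : ℝ), 0, -1] i * (c w * ψ))) ∘ ρ w) * ∫ g, a' (g * (UnitaryGroup.archDiagTorus L 3 α fun w => (fun i : Fin 3 => z₀ w i * Circle.exp (![(1 : ℝ), 0, -1] i * (c w * ψ))) ∘ ρ w) * g⁻¹) ∂ν') := by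
    intro ρ' hρ'
    rw [Finset.mem_filter] at hρ'
    have he := hρ'.2
    -- same fibre, same class values
    have hfib : (Finset.univ.filter fun ρ'' : {w : InfinitePlace L // IsComplex w} → Perm (Fin 3) => ConjClasses.mk (UnitaryGroup.archDiagTorus L 3 α fun w => (fun i : Fin 3 => z₀ w i * Circle.exp (![(1 : ℝ), 0, -1] i * (c w * ψ))) ∘ ρ'' w) = ConjClasses.mk (UnitaryGroup.archDiagTorus L 3 α fun w => (fun i : Fin 3 => z₀ w i * Circle.exp (![(1 : ℝ), 0, -1] i * (c w * ψ))) ∘ ρ' w)) =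
        Finset.univ.filter fun ρ'' : {w : InfinitePlace L // IsComplex w} → Perm (Fin 3) => ConjClasses.mk (UnitaryGroup.archDiagTorus L 3 α fun w => (fun i : Fin 3 => z₀ w i * Circle.exp (![(1 : ℝ), 0, -1] i * (c w * ψ))) ∘ ρ'' w) = ConjClasses.mk (UnitaryGroup.archDiagTorus L 3 α fun w => (fun i : Fin 3 => z₀ w i * Circle.exp (![(1 : ℝ), 0, -1] i * (c w * ψ))) ∘ ρ w) := by
      ext ρ''; simp only [Finset.mem_filter, Finset.mem_univ, true_and, he]
    rw [hfib, ← transferFactor_delta_out_mk L (Matrix.diagonal α) T (γH ψ) (UnitaryGroup.archDiagTorus L 3 α fun w => (fun i : Fin 3 => z₀ w i * Circle.exp (![(1 : ℝ), 0, -1] i * (c w * ψ))) ∘ ρ' w), ← integral_comp_conj_out_mk ν' a' (UnitaryGroup.archDiagTorus L 3 α fun w => (fun i : Fin 3 => z₀ w i * Circle.exp (![(1 : ℝ), 0, -1] i * (c w * ψ))) ∘ ρ' w), he,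
      transferFactor_delta_out_mk, integral_comp_conj_out_mk]
  rw [Finset.sum_congr rfl hconst, Finset.sum_const, nsmul_eq_mul, ← mul_assoc, mul_inv_cancel₀, one_mul]
  exact Nat.cast_ne_zero.mpr (Finset.card_ne_zero.mpr ⟨ρ, Finset.mem_filter.mpr ⟨Finset.mem_univ _, rfl⟩⟩)

/-! ## §3 The multiplicities are `ψ`-free on the regular set; the curve is regular for small `ψ ≠ 0` -/

omit [MeasurableSpace ↥(UnitaryGroup.arch (↥(maximalRealSubfield L)) L (IsCMField.complexConj L) 3 (Matrix.diagonal α))] [BorelSpace ↥(UnitaryGroup.arch (↥(maximalRealSubfield L)) L (IsCMField.complexConj L) 3 (Matrix.diagonal α))] in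
open scoped Classical in
/-- **THE MULTIPLICITIES DO NOT SEE `z`**: for `z` with every `z_w` injective, `⟦t(z∘ρ′)⟧ = ⟦t(z∘ρ)⟧` iff `ρ′_w(P_w) = ρ_w(P_w)` at every place (`P_w = {i ∣ re σ_w(α_i) > 0}`; ★ FILE C
`mk_archDiagTorus_eq_mk_iff_forall` ∘ ★ `mk_circleDiagonal_eq_mk_iff_image_eq_image`), so the fibre cardinality is the `z`-free number
`#{ρ′ ∣ ∀ w, ρ′_w(P_w) = ρ_w(P_w)}`. [cite: Rogawski1990, §3.8 pp. 30–32; §4.1 (4.1.1) p. 39] -/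
theorem card_filter_mk_relabel_eq_of_injective (hα : ∀ i, α i ≠ 0) (hreal : ∀ (w : {w : InfinitePlace L // IsComplex w}) (i : Fin 3), (w.1.embedding (α i)).im = 0)
    (z : {w : InfinitePlace L // IsComplex w} → Fin 3 → Circle) (hz : ∀ w, Function.Injective (z w)) (ρ : {w : InfinitePlace L // IsComplex w} → Perm (Fin 3)) :
    (Finset.univ.filter fun ρ' : {w : InfinitePlace L // IsComplex w} → Perm (Fin 3) =>
        ConjClasses.mk (UnitaryGroup.archDiagTorus L 3 α fun w => z w ∘ ρ' w) = ConjClasses.mk (UnitaryGroup.archDiagTorus L 3 α fun w => z w ∘ ρ w)).card =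
      (Finset.univ.filter fun ρ' : {w : InfinitePlace L // IsComplex w} → Perm (Fin 3) => ∀ w : {w : InfinitePlace L // IsComplex w},
        (Finset.univ.filter fun i : Fin 3 => 0 < (w.1.embedding (α i)).re).image (ρ' w) =
          (Finset.univ.filter fun i : Fin 3 => 0 < (w.1.embedding (α i)).re).image (ρ w)).card := by
  refine congrArg Finset.card (Finset.filter_congr fun ρ' _ => ?_)
  rw [UnitaryGroup.mk_archDiagTorus_eq_mk_iff_forall]
  refine forall_congr' fun w => ?_
  exact UnitaryGroup.mk_circleDiagonal_eq_mk_iff_image_eq_image 3 (UnitaryGroup.archLocal L 3 (Matrix.diagonal α) w) (fun i => (w.1.embedding (α i)).re)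
    (UnitaryGroup.mem_archLocal_diagonal_iff_mem_unitaryGroupOfForm L 3 α w (hreal w)) (UnitaryGroup.re_embedding_ne_zero L 3 α w hα (hreal w)) (hz w) (ρ' w) (ρ w)

omit [NumberField L] [IsCMField L] [MeasurableSpace ↥(UnitaryGroup.arch (↥(maximalRealSubfield L)) L (IsCMField.complexConj L) 3 (Matrix.diagonal α))] [BorelSpace ↥(UnitaryGroup.arch (↥(maximalRealSubfield L)) L (IsCMField.complexConj L) 3 (Matrix.diagonal α))] in
/-- **THE CURVE IS REGULAR FOR SMALL `ψ ≠ 0`**: at `w₀` the coordinates `ζe^{icψ}, ζ, ζe^{−icψ}` are pairwise distinct for `0 < |c ψ| < π`; off `w₀` nothing moves and the base is regular by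
hypothesis. [cite: Rogawski1990, §14.5 p. 238] -/
theorem eventually_injective_centralCurve (hc₀ : c w₀ ≠ 0) (hc : ∀ w, w ≠ w₀ → c w = 0) (hcen : z₀ w₀ 0 = z₀ w₀ 1 ∧ z₀ w₀ 2 = z₀ w₀ 1)
    (hinj : ∀ w, w ≠ w₀ → Function.Injective (z₀ w)) :
    ∀ᶠ ψ in 𝓝[≠] (0 : ℝ), ∀ w : {w : InfinitePlace L // IsComplex w}, Function.Injective (fun i : Fin 3 => z₀ w i * Circle.exp (![(1 : ℝ), 0, -1] i * (c w * ψ))) := by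
  have hsmall : ∀ᶠ ψ in 𝓝 (0 : ℝ), |c w₀ * ψ| < π / 2 := by
    have hcont : ContinuousAt (fun ψ : ℝ => |c w₀ * ψ|) 0 := (continuous_abs.comp (continuous_const.mul continuous_id)).continuousAt
    have h0 : |c w₀ * (0 : ℝ)| < π / 2 := by rw [mul_zero, abs_zero]; positivity
    exact hcont.eventually (gt_mem_nhds h0)
  filter_upwards [mem_nhdsWithin_of_mem_nhds hsmall, self_mem_nhdsWithin] with ψ hψ hψ0 w
  rw [Set.mem_compl_iff, Set.mem_singleton_iff] at hψ0
  by_cases hw : w = w₀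
  · subst hw
    -- the three coordinates `ζ e^{ix}, ζ, ζ e^{-ix}`, `x = cψ`, `0 < |x| < π/2`
    have hx0 : c w * ψ ≠ 0 := mul_ne_zero hc₀ hψ0
    have hexp : ∀ t : ℝ, |t| < π → t ≠ 0 → Circle.exp t ≠ 1 := by
      intro t ht ht0 h1
      rw [Circle.exp_eq_one] at h1
      obtain ⟨n, hn⟩ := h1
      have hn0 : n ≠ 0 := by rintro rfl; apply ht0; rw [hn]; simp
      have h1 : (1 : ℝ) ≤ |(n : ℝ)| := by exact_mod_cast Int.one_le_abs hn0
      have habs : |t| = |(n : ℝ)| * (2 * π) := by rw [hn, abs_mul, abs_of_pos (by positivity : (0 : ℝ) < 2 * π)]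
      nlinarith [Real.pi_pos, habs, ht]
    have hζ : z₀ w 0 = z₀ w 1 ∧ z₀ w 2 = z₀ w 1 := hcen
    intro i j hij
    simp only at hij
    -- reduce to `Circle.exp (e_i x) = Circle.exp (e_j x)`
    have hij' : Circle.exp (![(1 : ℝ), 0, -1] i * (c w * ψ)) = Circle.exp (![(1 : ℝ), 0, -1] j * (c w * ψ)) := by
      have hzi : z₀ w i = z₀ w 1 := by fin_cases i; exacts [hζ.1, rfl, hζ.2]
      have hzj : z₀ w j = z₀ w 1 := by fin_cases j; exacts [hζ.1, rfl, hζ.2]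
      rw [hzi, hzj] at hij
      exact mul_left_cancel hij
    rw [← div_eq_one, ← Circle.exp_sub, ← sub_mul] at hij'
    by_contra hne
    refine hexp _ ?_ ?_ hij'
    · have hcoef : |![(1 : ℝ), 0, -1] i - ![(1 : ℝ), 0, -1] j| ≤ 2 := by
        fin_cases i <;> fin_cases j <;> simp <;> norm_num
      calc |(![(1 : ℝ), 0, -1] i - ![(1 : ℝ), 0, -1] j) * (c w * ψ)| = |![(1 : ℝ), 0, -1] i - ![(1 : ℝ), 0, -1] j| * |c w * ψ| := abs_mul _ _
        _ ≤ 2 * |c w * ψ| := mul_le_mul_of_nonneg_right hcoef (abs_nonneg _)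
        _ < π := by linarith
    · refine mul_ne_zero ?_ hx0
      fin_cases i <;> fin_cases j <;> first | exact absurd rfl hne | norm_num
  · -- static regular place
    intro i j hij
    simp only [hc w hw, zero_mul, mul_zero, Circle.exp_zero, mul_one] at hij
    exact hinj w hw hij

/-! ## §4 The model combination `r(ψ) = (2 sin ψ)·Σ_ρ k_ρ·c_T·Δ″_ρ(ψ)·O_ρ(ψ)`: derivative and limits (any coefficients `k`, any `O_ρ`) -/

include hγH hγG in
omit [MeasurableSpace ↥(UnitaryGroup.arch (↥(maximalRealSubfield L)) L (IsCMField.complexConj L) 3 (Matrix.diagonal α))] [BorelSpace ↥(UnitaryGroup.arch (↥(maximalRealSubfield L)) L (IsCMField.complexConj L) 3 (Matrix.diagonal α))] in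
open scoped Classical in
/-- **DERIVATIVE OF THE MODEL COMBINATION** at a point `ψ₀` with `cos(c_{w₀}ψ₀) ≠ 1` where every `O_ρ` is differentiable: product∕sum rule over ★ G4b. [cite: Rogawski1990, §14.5 Lemma 14.5.2 (c), p. 238] -/
theorem hasDerivAt_gSide_model (hμu : μ.IsUnitary) (hc : ∀ w, w ≠ w₀ → c w = 0) (hcen : z₀ w₀ 0 = z₀ w₀ 1 ∧ z₀ w₀ 2 = z₀ w₀ 1)
    (hreg : ∀ w, w ≠ w₀ → z₀ w 1 ≠ z₀ w 0 ∧ z₀ w 1 ≠ z₀ w 2) (O : ({w : InfinitePlace L // IsComplex w} → Perm (Fin 3)) → ℝ → ℂ) (k : ({w : InfinitePlace L // IsComplex w} → Perm (Fin 3)) → ℂ) (cT : ℂ)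
    {ψ₀ : ℝ} (hψ₀ : Real.cos (c w₀ * ψ₀) ≠ 1) (hOψ : ∀ ρ, DifferentiableAt ℝ (O ρ) ψ₀) :
    HasDerivAt (fun ψ : ℝ => (2 * Real.sin ψ) • ∑ ρ : {w : InfinitePlace L // IsComplex w} → Perm (Fin 3), k ρ * (cT * (archExplicitDelta L (Matrix.diagonal α) (γH ψ) μ (UnitaryGroup.archDiagTorus L 3 α fun w => (fun i : Fin 3 => z₀ w i * Circle.exp (![(1 : ℝ), 0, -1] i * (c w * ψ))) ∘ ρ w) * O ρ ψ)))
      ((2 * Real.sin ψ₀) • (∑ ρ : {w : InfinitePlace L // IsComplex w} → Perm (Fin 3), k ρ * (cT * deriv (fun ψ : ℝ => archExplicitDelta L (Matrix.diagonal α) (γH ψ) μ (UnitaryGroup.archDiagTorus L 3 α fun w => (fun i : Fin 3 => z₀ w i * Circle.exp (![(1 : ℝ), 0, -1] i * (c w * ψ))) ∘ ρ w) * O ρ ψ) ψ₀)) +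
        (2 * Real.cos ψ₀) • ∑ ρ : {w : InfinitePlace L // IsComplex w} → Perm (Fin 3), k ρ * (cT * (archExplicitDelta L (Matrix.diagonal α) (γH ψ₀) μ (UnitaryGroup.archDiagTorus L 3 α fun w => (fun i : Fin 3 => z₀ w i * Circle.exp (![(1 : ℝ), 0, -1] i * (c w * ψ₀))) ∘ ρ w) * O ρ ψ₀))) ψ₀ := by
  have hSd : ∀ ρ : {w : InfinitePlace L // IsComplex w} → Perm (Fin 3), HasDerivAt (fun ψ : ℝ => archExplicitDelta L (Matrix.diagonal α) (γH ψ) μ (UnitaryGroup.archDiagTorus L 3 α fun w => (fun i : Fin 3 => z₀ w i * Circle.exp (![(1 : ℝ), 0, -1] i * (c w * ψ))) ∘ ρ w) * O ρ ψ)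
      (deriv (fun ψ : ℝ => archExplicitDelta L (Matrix.diagonal α) (γH ψ) μ (UnitaryGroup.archDiagTorus L 3 α fun w => (fun i : Fin 3 => z₀ w i * Circle.exp (![(1 : ℝ), 0, -1] i * (c w * ψ))) ∘ ρ w) * O ρ ψ) ψ₀) ψ₀ := fun ρ =>
    (DifferentiableAt.mul (differentiableAt_archExplicitDelta_centralCurve_relabel_and_norm_deriv_le L α z₀ c γH γG hγH hγG ρ _ rfl w₀ μ hμu hc hcen
      hreg hψ₀).1 (hOψ ρ)).hasDerivAt
  have hsum := HasDerivAt.fun_sum (u := (Finset.univ : Finset ({w : InfinitePlace L // IsComplex w} → Perm (Fin 3)))) fun ρ _ => ((hSd ρ).const_mul cT).const_mul (k ρ)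
  have hsin : HasDerivAt (fun ψ : ℝ => 2 * Real.sin ψ) (2 * Real.cos ψ₀) ψ₀ := (Real.hasDerivAt_sin ψ₀).const_mul 2
  exact hsin.smul hsum

include hγH hγG in
omit [MeasurableSpace ↥(UnitaryGroup.arch (↥(maximalRealSubfield L)) L (IsCMField.complexConj L) 3 (Matrix.diagonal α))] [BorelSpace ↥(UnitaryGroup.arch (↥(maximalRealSubfield L)) L (IsCMField.complexConj L) 3 (Matrix.diagonal α))] in
open scoped Classical in
/-- **THE MODEL COMBINATION IS DIFFERENTIABLE ON A PUNCTURED NEIGHBOURHOOD OF `0`** when every `O_ρ` is differentiable near `0`. [cite: Rogawski1990, §14.5 Lemma 14.5.2 (c), p. 238] -/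
theorem eventually_differentiableAt_gSide_model (hμu : μ.IsUnitary) (hc₀ : c w₀ ≠ 0) (hc : ∀ w, w ≠ w₀ → c w = 0)
    (hcen : z₀ w₀ 0 = z₀ w₀ 1 ∧ z₀ w₀ 2 = z₀ w₀ 1) (hreg : ∀ w, w ≠ w₀ → z₀ w 1 ≠ z₀ w 0 ∧ z₀ w 1 ≠ z₀ w 2)
    (O : ({w : InfinitePlace L // IsComplex w} → Perm (Fin 3)) → ℝ → ℂ) (k : ({w : InfinitePlace L // IsComplex w} → Perm (Fin 3)) → ℂ) (cT : ℂ) (hO : ∀ ρ, ∀ᶠ ψ in 𝓝 (0 : ℝ), DifferentiableAt ℝ (O ρ) ψ) :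
    ∀ᶠ ψ₀ in 𝓝[≠] (0 : ℝ), DifferentiableAt ℝ
      (fun ψ : ℝ => (2 * Real.sin ψ) • ∑ ρ : {w : InfinitePlace L // IsComplex w} → Perm (Fin 3), k ρ * (cT * (archExplicitDelta L (Matrix.diagonal α) (γH ψ) μ (UnitaryGroup.archDiagTorus L 3 α fun w => (fun i : Fin 3 => z₀ w i * Circle.exp (![(1 : ℝ), 0, -1] i * (c w * ψ))) ∘ ρ w) * O ρ ψ))) ψ₀ := by
  have hsmall : ∀ᶠ ψ in 𝓝 (0 : ℝ), |c w₀ * ψ| ≤ π / 2 := by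
    have hcont : ContinuousAt (fun ψ : ℝ => |c w₀ * ψ|) 0 := (continuous_abs.comp (continuous_const.mul continuous_id)).continuousAt
    have h0 : |c w₀ * (0 : ℝ)| < π / 2 := by rw [mul_zero, abs_zero]; positivity
    exact (hcont.eventually (gt_mem_nhds h0)).mono fun ψ hψ => hψ.le
  filter_upwards [mem_nhdsWithin_of_mem_nhds hsmall, mem_nhdsWithin_of_mem_nhds (Filter.eventually_all.mpr hO), self_mem_nhdsWithin] with ψ hψs hOψ hψ0
  rw [Set.mem_compl_iff, Set.mem_singleton_iff] at hψ0
  have hcos : Real.cos (c w₀ * ψ) ≠ 1 := by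
    intro h1
    rw [Real.cos_eq_one_iff] at h1
    obtain ⟨m, hm⟩ := h1
    have hx0 : c w₀ * ψ ≠ 0 := mul_ne_zero hc₀ hψ0
    have hm0 : m ≠ 0 := by rintro rfl; apply hx0; rw [← hm]; simp
    have h1 : (1 : ℝ) ≤ |(m : ℝ)| := by exact_mod_cast Int.one_le_abs hm0
    have habs : |c w₀ * ψ| = |(m : ℝ)| * (2 * π) := by rw [← hm, abs_mul, abs_of_pos (by positivity : (0 : ℝ) < 2 * π)]
    nlinarith [Real.pi_pos, habs, hψs]
  exact (hasDerivAt_gSide_model L α z₀ c γH γG hγH hγG w₀ μ hμu hc hcen hreg O k cT hcos hOψ).differentiableAt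

include hγH hγG in
omit [MeasurableSpace ↥(UnitaryGroup.arch (↥(maximalRealSubfield L)) L (IsCMField.complexConj L) 3 (Matrix.diagonal α))] [BorelSpace ↥(UnitaryGroup.arch (↥(maximalRealSubfield L)) L (IsCMField.complexConj L) 3 (Matrix.diagonal α))] in
open scoped Classical in
/-- **THE DERIVATIVE OF THE MODEL COMBINATION TENDS TO `0`** at the centre when every `O_ρ` is differentiable near `0` with `O_ρ`, `O_ρ′` bounded: `r′ = 2cos·Σ + 2sin·Σ′`, `Σ → 0` (`Δ″_ρ = O(ψ²)`),
`Σ′ → 0` (★ G4b `∂(Δ″_ρ·O_ρ) → 0`). [cite: Rogawski1990, §14.5 Lemma 14.5.2 (c), p. 238] -/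
theorem tendsto_deriv_gSide_model (hμu : μ.IsUnitary) (hc₀ : c w₀ ≠ 0) (hc : ∀ w, w ≠ w₀ → c w = 0)
    (hcen : z₀ w₀ 0 = z₀ w₀ 1 ∧ z₀ w₀ 2 = z₀ w₀ 1) (hreg : ∀ w, w ≠ w₀ → z₀ w 1 ≠ z₀ w 0 ∧ z₀ w 1 ≠ z₀ w 2)
    (O : ({w : InfinitePlace L // IsComplex w} → Perm (Fin 3)) → ℝ → ℂ) (k : ({w : InfinitePlace L // IsComplex w} → Perm (Fin 3)) → ℂ) (cT : ℂ)
    (hO : ∀ ρ, (∀ᶠ ψ in 𝓝 (0 : ℝ), DifferentiableAt ℝ (O ρ) ψ) ∧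
      ∃ M : ℝ, (∀ᶠ ψ in 𝓝 (0 : ℝ), ‖O ρ ψ‖ ≤ M) ∧ ∀ᶠ ψ in 𝓝 (0 : ℝ), ‖deriv (O ρ) ψ‖ ≤ M) :
    Tendsto (fun ψ₀ => deriv (fun ψ : ℝ => (2 * Real.sin ψ) • ∑ ρ : {w : InfinitePlace L // IsComplex w} → Perm (Fin 3), k ρ * (cT * (archExplicitDelta L (Matrix.diagonal α) (γH ψ) μ (UnitaryGroup.archDiagTorus L 3 α fun w => (fun i : Fin 3 => z₀ w i * Circle.exp (![(1 : ℝ), 0, -1] i * (c w * ψ))) ∘ ρ w) * O ρ ψ))) ψ₀)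
      (𝓝[≠] 0) (𝓝 0) := by
  have hS0 : ∀ ρ : {w : InfinitePlace L // IsComplex w} → Perm (Fin 3), Tendsto (fun ψ : ℝ => archExplicitDelta L (Matrix.diagonal α) (γH ψ) μ (UnitaryGroup.archDiagTorus L 3 α fun w => (fun i : Fin 3 => z₀ w i * Circle.exp (![(1 : ℝ), 0, -1] i * (c w * ψ))) ∘ ρ w) * O ρ ψ) (𝓝[≠] 0) (𝓝 0) := by
    intro ρ
    obtain ⟨M, hM, -⟩ := (hO ρ).2
    have hb : ∀ᶠ ψ in 𝓝[≠] (0 : ℝ), ‖archExplicitDelta L (Matrix.diagonal α) (γH ψ) μ (UnitaryGroup.archDiagTorus L 3 α fun w => (fun i : Fin 3 => z₀ w i * Circle.exp (![(1 : ℝ), 0, -1] i * (c w * ψ))) ∘ ρ w) * O ρ ψ‖ ≤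
        (∏ w ∈ Finset.univ.erase w₀, ‖((z₀ w 1 : ℂ) - z₀ w 0) * ((z₀ w 1 : ℂ) - z₀ w 2)‖) * (c w₀) ^ 2 * ψ ^ 2 * M := by
      filter_upwards [mem_nhdsWithin_of_mem_nhds hM] with ψ hMψ
      rw [norm_mul]
      exact mul_le_mul (norm_archExplicitDelta_centralCurve_relabel_le_sq L α z₀ c γH γG hγH hγG ρ _ rfl w₀ μ hμu hc hcen hreg ψ) hMψ (norm_nonneg _)
        (by positivity)
    refine squeeze_zero_norm' hb ?_
    have h : Tendsto (fun ψ : ℝ => (∏ w ∈ Finset.univ.erase w₀, ‖((z₀ w 1 : ℂ) - z₀ w 0) * ((z₀ w 1 : ℂ) - z₀ w 2)‖) * (c w₀) ^ 2 * ψ ^ 2 * M) (𝓝 0)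
        (𝓝 ((∏ w ∈ Finset.univ.erase w₀, ‖((z₀ w 1 : ℂ) - z₀ w 0) * ((z₀ w 1 : ℂ) - z₀ w 2)‖) * (c w₀) ^ 2 * (0 : ℝ) ^ 2 * M)) :=
      ((continuous_const.mul (continuous_pow 2)).mul continuous_const).tendsto 0
    simp only [ne_eq, OfNat.ofNat_ne_zero, not_false_eq_true, zero_pow, mul_zero, zero_mul] at h
    exact h.mono_left nhdsWithin_le_nhds
  have hS' : ∀ ρ : {w : InfinitePlace L // IsComplex w} → Perm (Fin 3), Tendsto (fun ψ₀ => deriv (fun ψ : ℝ => archExplicitDelta L (Matrix.diagonal α) (γH ψ) μ (UnitaryGroup.archDiagTorus L 3 α fun w => (fun i : Fin 3 => z₀ w i * Circle.exp (![(1 : ℝ), 0, -1] i * (c w * ψ))) ∘ ρ w) * O ρ ψ) ψ₀) (𝓝[≠] 0) (𝓝 0) :=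
    fun ρ => by
      obtain ⟨M, hM, hM'⟩ := (hO ρ).2
      exact tendsto_deriv_archExplicitDelta_centralCurve_relabel_mul L α z₀ c γH γG hγH hγG ρ _ rfl w₀ μ hμu hc₀ hc hcen hreg (hO ρ).1 hM hM'
  have hSum : Tendsto (fun ψ : ℝ => ∑ ρ : {w : InfinitePlace L // IsComplex w} → Perm (Fin 3), k ρ * (cT * (archExplicitDelta L (Matrix.diagonal α) (γH ψ) μ (UnitaryGroup.archDiagTorus L 3 α fun w => (fun i : Fin 3 => z₀ w i * Circle.exp (![(1 : ℝ), 0, -1] i * (c w * ψ))) ∘ ρ w) * O ρ ψ))) (𝓝[≠] 0) (𝓝 0) := by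
    have h := tendsto_finsetSum (Finset.univ : Finset ({w : InfinitePlace L // IsComplex w} → Perm (Fin 3))) fun ρ _ => ((hS0 ρ).const_mul cT).const_mul (k ρ)
    rw [show (∑ ρ ∈ (Finset.univ : Finset ({w : InfinitePlace L // IsComplex w} → Perm (Fin 3))), k ρ * (cT * (0 : ℂ))) = 0 by simp only [mul_zero, Finset.sum_const_zero]] at h
    exact h
  have hSum' : Tendsto (fun ψ₀ : ℝ => ∑ ρ : {w : InfinitePlace L // IsComplex w} → Perm (Fin 3), k ρ * (cT * deriv (fun ψ : ℝ => archExplicitDelta L (Matrix.diagonal α) (γH ψ) μ (UnitaryGroup.archDiagTorus L 3 α fun w => (fun i : Fin 3 => z₀ w i * Circle.exp (![(1 : ℝ), 0, -1] i * (c w * ψ))) ∘ ρ w) * O ρ ψ) ψ₀))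
      (𝓝[≠] 0) (𝓝 0) := by
    have h := tendsto_finsetSum (Finset.univ : Finset ({w : InfinitePlace L // IsComplex w} → Perm (Fin 3))) fun ρ _ => ((hS' ρ).const_mul cT).const_mul (k ρ)
    rw [show (∑ ρ ∈ (Finset.univ : Finset ({w : InfinitePlace L // IsComplex w} → Perm (Fin 3))), k ρ * (cT * (0 : ℂ))) = 0 by simp only [mul_zero, Finset.sum_const_zero]] at h
    exact h
  have hcosb : Tendsto (fun ψ : ℝ => 2 * Real.cos ψ) (𝓝[≠] 0) (𝓝 (2 * Real.cos 0)) :=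
    ((Real.continuous_cos.tendsto 0).const_mul 2).mono_left nhdsWithin_le_nhds
  have hsinb : Tendsto (fun ψ : ℝ => 2 * Real.sin ψ) (𝓝[≠] 0) (𝓝 (2 * Real.sin 0)) :=
    ((Real.continuous_sin.tendsto 0).const_mul 2).mono_left nhdsWithin_le_nhds
  have hlim := (hsinb.smul hSum').add (hcosb.smul hSum)
  rw [smul_zero, smul_zero, add_zero] at hlim
  have hsmall : ∀ᶠ ψ in 𝓝 (0 : ℝ), |c w₀ * ψ| ≤ π / 2 := by
    have hcont : ContinuousAt (fun ψ : ℝ => |c w₀ * ψ|) 0 := (continuous_abs.comp (continuous_const.mul continuous_id)).continuousAt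
    have h0 : |c w₀ * (0 : ℝ)| < π / 2 := by rw [mul_zero, abs_zero]; positivity
    exact (hcont.eventually (gt_mem_nhds h0)).mono fun ψ hψ => hψ.le
  refine (tendsto_congr' ?_).mpr hlim
  filter_upwards [mem_nhdsWithin_of_mem_nhds hsmall, mem_nhdsWithin_of_mem_nhds (Filter.eventually_all.mpr fun ρ => (hO ρ).1), self_mem_nhdsWithin]
    with ψ hψs hOψ hψ0
  rw [Set.mem_compl_iff, Set.mem_singleton_iff] at hψ0
  have hcos : Real.cos (c w₀ * ψ) ≠ 1 := by
    intro h1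
    rw [Real.cos_eq_one_iff] at h1
    obtain ⟨m, hm⟩ := h1
    have hx0 : c w₀ * ψ ≠ 0 := mul_ne_zero hc₀ hψ0
    have hm0 : m ≠ 0 := by rintro rfl; apply hx0; rw [← hm]; simp
    have h1 : (1 : ℝ) ≤ |(m : ℝ)| := by exact_mod_cast Int.one_le_abs hm0
    have habs : |c w₀ * ψ| = |(m : ℝ)| * (2 * π) := by rw [← hm, abs_mul, abs_of_pos (by positivity : (0 : ℝ) < 2 * π)]
    nlinarith [Real.pi_pos, habs, hψs]
  exact (hasDerivAt_gSide_model L α z₀ c γH γG hγH hγG w₀ μ hμu hc hcen hreg O k cT hcos hOψ).deriv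

/-! ## §5 The head: the `G′`-side is flat at the centre (modulo the orbital smoothness `hO`) -/

include hγH hγG in
open scoped Classical in
/-- **THE `G′`-SIDE AS THE MODEL COMBINATION ON THE REGULAR SET**: for `ψ` with every `z(ψ)_w` injective, with `T.Δ = c_T·Δ″` and `n_ρ` the `ψ`-free multiplicity of §3.
[cite: Rogawski1990, §4.1 (4.1.1) p. 39; §4.3 p. 43] -/
theorem finsum_delta_mul_integral_eq_model_of_injective (hα : ∀ i, α i ≠ 0) (hherm : ∀ i, (IsCMField.complexConj L (α i) : L) = α i)
    (hreal : ∀ (w : {w : InfinitePlace L // IsComplex w}) (i : Fin 3), (w.1.embedding (α i)).im = 0) (cT : ℂ) (hT : ∀ a b, T.Δ a b = cT * archExplicitDelta L (Matrix.diagonal α) a μ b)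
    (ψ : ℝ) (hψinj : ∀ w : {w : InfinitePlace L // IsComplex w}, Function.Injective (fun i : Fin 3 => z₀ w i * Circle.exp (![(1 : ℝ), 0, -1] i * (c w * ψ)))) :
    ∑ᶠ c' : ConjClasses ↥(UnitaryGroup.arch (↥(maximalRealSubfield L)) L (IsCMField.complexConj L) 3 (Matrix.diagonal α)), T.Δ (γH ψ) (Quotient.out c') * ∫ g, a' (g * Quotient.out c' * g⁻¹) ∂ν' =
      ∑ ρ : {w : InfinitePlace L // IsComplex w} → Perm (Fin 3), (((Finset.univ.filter fun ρ' : {w : InfinitePlace L // IsComplex w} → Perm (Fin 3) => ∀ w : {w : InfinitePlace L // IsComplex w}, (Finset.univ.filter fun i : Fin 3 => 0 < (w.1.embedding (α i)).re).image (ρ' w) = (Finset.univ.filter fun i : Fin 3 => 0 < (w.1.embedding (α i)).re).image (ρ w)).card : ℕ) : ℂ)⁻¹ *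
        (cT * (archExplicitDelta L (Matrix.diagonal α) (γH ψ) μ (UnitaryGroup.archDiagTorus L 3 α fun w => (fun i : Fin 3 => z₀ w i * Circle.exp (![(1 : ℝ), 0, -1] i * (c w * ψ))) ∘ ρ w) * ∫ g, a' (g * (UnitaryGroup.archDiagTorus L 3 α fun w => (fun i : Fin 3 => z₀ w i * Circle.exp (![(1 : ℝ), 0, -1] i * (c w * ψ))) ∘ ρ w) * g⁻¹) ∂ν')) := by
  rw [finsum_delta_mul_integral_eq_sum_relabel L α z₀ c γH γG hγH hγG T ν' a' hα hherm ψ]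
  refine Finset.sum_congr rfl fun ρ _ => ?_
  rw [card_filter_mk_relabel_eq_of_injective L α hα hreal _ hψinj ρ, hT, mul_assoc]

include hγH hγG in
open scoped Classical in
/-- **THE `G′`-SIDE OF (vi) ALONG THE CENTRAL CURVE IS FLAT** (F0P3a-p02 (g10)'s (3G) head): there is `r : ℝ → ℂ`, differentiable on a punctured neighbourhood of `0` with `r′ → 0` there, agreeing
on a punctured neighbourhood of `0` with `(2 sin ψ) • Σᶠ_{c′} T.Δ(γ_H(ψ), out c′) · ∫ a′(g·out c′·g⁻¹) dν′` — GIVEN (3G-b) `hO`: each relabelled orbital integral `O_ρ(ψ) = ∫ a′(g·t(z(ψ)∘ρ)·g⁻¹) dν′` is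
differentiable near `0` with `O_ρ`, `O_ρ′` bounded there (`r` = the model combination of §4 with `k_ρ = n_ρ⁻¹`). [cite: Rogawski1990, §14.5 Lemma 14.5.2 (c), p. 238] -/
theorem exists_flat_gSide_centralCurve (hα : ∀ i, α i ≠ 0) (hherm : ∀ i, (IsCMField.complexConj L (α i) : L) = α i)
    (hreal : ∀ (w : {w : InfinitePlace L // IsComplex w}) (i : Fin 3), (w.1.embedding (α i)).im = 0) (hμu : μ.IsUnitary) (cT : ℂ)
    (hT : ∀ a b, T.Δ a b = cT * archExplicitDelta L (Matrix.diagonal α) a μ b)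
    (hc₀ : c w₀ ≠ 0) (hc : ∀ w, w ≠ w₀ → c w = 0) (hcen : z₀ w₀ 0 = z₀ w₀ 1 ∧ z₀ w₀ 2 = z₀ w₀ 1) (hinj : ∀ w, w ≠ w₀ → Function.Injective (z₀ w))
    (hO : ∀ ρ : {w : InfinitePlace L // IsComplex w} → Perm (Fin 3),
      (∀ᶠ ψ in 𝓝 (0 : ℝ), DifferentiableAt ℝ (fun ψ : ℝ => ∫ g, a' (g * (UnitaryGroup.archDiagTorus L 3 α fun w => (fun i : Fin 3 => z₀ w i * Circle.exp (![(1 : ℝ), 0, -1] i * (c w * ψ))) ∘ ρ w) * g⁻¹) ∂ν') ψ) ∧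
        ∃ M : ℝ, (∀ᶠ ψ in 𝓝 (0 : ℝ), ‖∫ g, a' (g * (UnitaryGroup.archDiagTorus L 3 α fun w => (fun i : Fin 3 => z₀ w i * Circle.exp (![(1 : ℝ), 0, -1] i * (c w * ψ))) ∘ ρ w) * g⁻¹) ∂ν'‖ ≤ M) ∧
          ∀ᶠ ψ in 𝓝 (0 : ℝ), ‖deriv (fun ψ : ℝ => ∫ g, a' (g * (UnitaryGroup.archDiagTorus L 3 α fun w => (fun i : Fin 3 => z₀ w i * Circle.exp (![(1 : ℝ), 0, -1] i * (c w * ψ))) ∘ ρ w) * g⁻¹) ∂ν') ψ‖ ≤ M) :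
    ∃ r : ℝ → ℂ, (∀ᶠ ψ in 𝓝[≠] (0 : ℝ), DifferentiableAt ℝ r ψ) ∧ Tendsto (deriv r) (𝓝[≠] 0) (𝓝 0) ∧
      ∀ᶠ ψ in 𝓝[≠] (0 : ℝ), (2 * Real.sin ψ) • ∑ᶠ c' : ConjClasses ↥(UnitaryGroup.arch (↥(maximalRealSubfield L)) L (IsCMField.complexConj L) 3 (Matrix.diagonal α)), T.Δ (γH ψ) (Quotient.out c') * ∫ g, a' (g * Quotient.out c' * g⁻¹) ∂ν' = r ψ := by
  have hreg : ∀ w, w ≠ w₀ → z₀ w 1 ≠ z₀ w 0 ∧ z₀ w 1 ≠ z₀ w 2 := fun w hw =>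
    ⟨fun h => absurd ((hinj w hw) h) (by decide), fun h => absurd ((hinj w hw) h) (by decide)⟩
  refine ⟨fun ψ => (2 * Real.sin ψ) • ∑ ρ : {w : InfinitePlace L // IsComplex w} → Perm (Fin 3), (((Finset.univ.filter fun ρ' : {w : InfinitePlace L // IsComplex w} → Perm (Fin 3) => ∀ w : {w : InfinitePlace L // IsComplex w}, (Finset.univ.filter fun i : Fin 3 => 0 < (w.1.embedding (α i)).re).image (ρ' w) = (Finset.univ.filter fun i : Fin 3 => 0 < (w.1.embedding (α i)).re).image (ρ w)).card : ℕ) : ℂ)⁻¹ *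
      (cT * (archExplicitDelta L (Matrix.diagonal α) (γH ψ) μ (UnitaryGroup.archDiagTorus L 3 α fun w => (fun i : Fin 3 => z₀ w i * Circle.exp (![(1 : ℝ), 0, -1] i * (c w * ψ))) ∘ ρ w) * (fun (ρ : {w : InfinitePlace L // IsComplex w} → Perm (Fin 3)) (ψ : ℝ) => ∫ g, a' (g * (UnitaryGroup.archDiagTorus L 3 α fun w => (fun i : Fin 3 => z₀ w i * Circle.exp (![(1 : ℝ), 0, -1] i * (c w * ψ))) ∘ ρ w) * g⁻¹) ∂ν') ρ ψ)), ?_, ?_, ?_⟩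
  · exact eventually_differentiableAt_gSide_model L α z₀ c γH γG hγH hγG w₀ μ hμu hc₀ hc hcen hreg
      (fun (ρ : {w : InfinitePlace L // IsComplex w} → Perm (Fin 3)) (ψ : ℝ) => ∫ g, a' (g * (UnitaryGroup.archDiagTorus L 3 α fun w => (fun i : Fin 3 => z₀ w i * Circle.exp (![(1 : ℝ), 0, -1] i * (c w * ψ))) ∘ ρ w) * g⁻¹) ∂ν') (fun ρ => (((Finset.univ.filter fun ρ' : {w : InfinitePlace L // IsComplex w} → Perm (Fin 3) => ∀ w : {w : InfinitePlace L // IsComplex w}, (Finset.univ.filter fun i : Fin 3 => 0 < (w.1.embedding (α i)).re).image (ρ' w) = (Finset.univ.filter fun i : Fin 3 => 0 < (w.1.embedding (α i)).re).image (ρ w)).card : ℕ) : ℂ)⁻¹) cT fun ρ => (hO ρ).1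
  · exact tendsto_deriv_gSide_model L α z₀ c γH γG hγH hγG w₀ μ hμu hc₀ hc hcen hreg
      (fun (ρ : {w : InfinitePlace L // IsComplex w} → Perm (Fin 3)) (ψ : ℝ) => ∫ g, a' (g * (UnitaryGroup.archDiagTorus L 3 α fun w => (fun i : Fin 3 => z₀ w i * Circle.exp (![(1 : ℝ), 0, -1] i * (c w * ψ))) ∘ ρ w) * g⁻¹) ∂ν') (fun ρ => (((Finset.univ.filter fun ρ' : {w : InfinitePlace L // IsComplex w} → Perm (Fin 3) => ∀ w : {w : InfinitePlace L // IsComplex w}, (Finset.univ.filter fun i : Fin 3 => 0 < (w.1.embedding (α i)).re).image (ρ' w) = (Finset.univ.filter fun i : Fin 3 => 0 < (w.1.embedding (α i)).re).image (ρ w)).card : ℕ) : ℂ)⁻¹) cT hO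
  · exact (eventually_injective_centralCurve L z₀ c w₀ hc₀ hc hcen hinj).mono fun ψ hψ =>
      congrArg (fun x : ℂ => (2 * Real.sin ψ) • x)
        (finsum_delta_mul_integral_eq_model_of_injective L α z₀ c γH γG hγH hγG μ T ν' a' hα hherm hreal cT hT ψ hψ)

end Curve

end Literature.NumberTheory.Rogawski1990

end
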